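import Literature.Geometry.Symplectic.JPlanePencilMemberCap
import Literature.Topology.FourManifolds.ComplexProjectiveSpacePositiveAtlas
import Literature.AlgebraicTopology.SingularHomology.ExcisionMayerVietorisProofs
import HarnessLib

/-!
# Pencil members as two-chart spheres `ℂP¹ → M`, and the vanishing of their homological pairings

Support theorems (no named facts, D-0026) for
`Literature.Geometry.Symplectic.jPlanePencil_localFamily_homotopySphere`
(`JPlanePencilLocalFamily.lean`; C. Wendl, *Holomorphic Curves in Low Dimensions* (2018),
Prop. 2.53 with `m = 1`, for homotopy 4-spheres).

* `twoChartGlue u v : ℂP¹ → X` — the map glued from two charts `u, v : ℂ → X` with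
  `v z = u z⁻¹` (`z ≠ 0`): `u` on `{v₀ ≠ 0}` in the affine coordinate `v₁/v₀`, `v` on `{v₁ ≠ 0}`
  in `v₀/v₁`; `continuous_twoChartGlue`; `twoChartSphere` the bundled `C(ℂP¹, X)` with the two
  compatibilities `twoChartSphere_apply_of_coordNeZero_zero/one` — exactly the shape of the test
  spheres of `sphere_zeroSetIndex_factorsThroughHomology_of_isClosed`
  (`SphereIntersectionIndexHomologicalNoncompact.lean`).
* `IsPencilPlane.capSphere` — a pencil member closed up through `p` (`JPlanePencilMemberCap.lean`)
  as such a sphere in `M`.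
* `isZero_singularHomology_two_of_homotopyEquiv_sphere_four` — `H₂(M; ℤ) = 0` for `M ≃ₕ S⁴`
  (homotopy invariance, `singularHomology.isoOfHomotopyEquiv`, and `H₂(S⁴) = 0`,
  `isZero_singularHomology_sphere_holds`); hence `addMonoidHom_apply_eq_zero_of_homotopyEquiv`:
  every additive functional on `H₂(M; ℤ)` vanishes on every class — in particular on the class of
  a capped member. This is where the hypothesis `Nonempty (M ≃ₕ S⁴)` of the pencil statement
  enters its universality clause (Wendl: `[û] = ℓ`, `ℓ · ℓ = 1` in `X̂ = M ∖ p ∪ ℂP¹`; in `M` itself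
  all pairings vanish and the whole intersection is carried by the constraint point `p`).

## References

* C. Wendl, *Holomorphic Curves in Low Dimensions*, LNM 2216, Springer (2018), Prop. 2.53,
  Thm. 2.49. [Wendl2018]
* P. Griffiths, J. Harris, *Principles of Algebraic Geometry* (1978), Ch. 0 §2 (affine charts of
  `ℂPⁿ`). [GriffithsHarrisPrinciples1978]
* A. Hatcher, *Algebraic Topology* (2002), Cor. 2.11, Cor. 2.14. [Hatcher2002]
-/

noncomputable section

open scoped Manifold ContDiff Topology
open Set Function Filter Metric Complex CategoryTheory CategoryTheory.Limits
open Literature.Topology.FourManifolds Literature.Topology.FourManifolds.ComplexProjectiveSpace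
  Literature.AlgebraicTopology.SingularHomology

namespace Literature.Geometry.Symplectic

/-! ### §1 Gluing two charts into a continuous map `ℂP¹ → X` -/

section Glue

variable {X : Type*}

open Classical in
/-- **The map glued from two charts.** For `u v : ℂ → X` (thought of as the restrictions of a
map `S² → X` to `S² ∖ ∞` and `S² ∖ 0`, `v z = u z⁻¹`): `u (v₁/v₀)` on `{v₀ ≠ 0}` and
`v (v₀/v₁)` at the remaining point `[0 : 1]`. [cite: GriffithsHarrisPrinciples1978, Ch. 0 §2] -/
def twoChartGlue (u v : ℂ → X) (q : ComplexProjectiveSpace 1) : X :=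
  if CoordNeZero 0 q then u (affineCoordComplex 0 q 0) else v (affineCoordComplex 1 q 0)

section Algebra

variable {u v : ℂ → X} {q : ComplexProjectiveSpace 1}

/-- On the chart `{v₀ ≠ 0}` the glued map is `u` in the coordinate `v₁/v₀`. [folklore] -/
theorem twoChartGlue_of_coordNeZero_zero (h0 : CoordNeZero 0 q) :
    twoChartGlue u v q = u (affineCoordComplex 0 q 0) := by
  simp [twoChartGlue, h0]

/-- At `[0 : 1]` the glued map is `v 0`. [folklore] -/
theorem twoChartGlue_of_not_coordNeZero_zero (h0 : ¬ CoordNeZero 0 q) :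
    twoChartGlue u v q = v (affineCoordComplex 1 q 0) := by
  simp [twoChartGlue, h0]

/-- On the overlap of the two charts the first affine coordinate is nonzero. [folklore] -/
theorem affineCoordComplex_zero_apply_ne_zero (h0 : CoordNeZero 0 q) (h1 : CoordNeZero 1 q) :
    affineCoordComplex 0 q 0 ≠ 0 := by
  induction q using ComplexProjectiveSpace.ind with
  | h w =>
    rw [affineCoordComplex_mk]
    exact div_ne_zero (by simpa using h1) (by simpa using h0)

/-- On the chart `{v₁ ≠ 0}` the glued map is `v` in the coordinate `v₀/v₁`, provided
`v z = u z⁻¹` for `z ≠ 0`. [folklore] -/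
theorem twoChartGlue_of_coordNeZero_one (huv : ∀ z : ℂ, z ≠ 0 → v z = u z⁻¹)
    (h1 : CoordNeZero 1 q) : twoChartGlue u v q = v (affineCoordComplex 1 q 0) := by
  by_cases h0 : CoordNeZero 0 q
  · rw [twoChartGlue_of_coordNeZero_zero h0, affineCoordComplex_one_eq_inv,
      huv _ (inv_ne_zero (affineCoordComplex_zero_apply_ne_zero h0 h1)), inv_inv]
  · exact twoChartGlue_of_not_coordNeZero_zero h0

end Algebra

variable [TopologicalSpace X]

/-- The affine coordinate `q ↦ v_{1-i} / v_i` of `ℂP¹` is continuous on its chart domain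
`{v_i ≠ 0}`. [cite: GriffithsHarrisPrinciples1978, Ch. 0 §2] -/
theorem continuousOn_affineCoordComplex_apply (i : Fin (1 + 1)) :
    ContinuousOn (fun q : ComplexProjectiveSpace 1 => affineCoordComplex i q 0)
      {q | CoordNeZero i q} := by
  have h1 : ContinuousOn (affineChart i) {q : ComplexProjectiveSpace 1 | CoordNeZero i q} :=
    (affineChart i).continuousOn
  have h2 : ∀ q : ComplexProjectiveSpace 1,
      affineCoordComplex i q 0 = (realCoordinates 1).symm (affineChart i q) 0 := by
    intro q
    rw [affineChart_apply_eq, ContinuousLinearEquiv.symm_apply_apply]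
  simp_rw [h2]
  exact ((continuous_apply 0).comp (realCoordinates 1).symm.continuous).comp_continuousOn h1

variable {u v : ℂ → X} {q : ComplexProjectiveSpace 1}

/-- **The glued map is continuous** when both charts are and they are compatible. [folklore] -/
theorem continuous_twoChartGlue (hu : Continuous u) (hv : Continuous v)
    (huv : ∀ z : ℂ, z ≠ 0 → v z = u z⁻¹) : Continuous (twoChartGlue u v) := by
  rw [continuous_iff_continuousAt]
  intro q
  by_cases h0 : CoordNeZero 0 q
  · have hc : ContinuousOn (twoChartGlue u v) {q : ComplexProjectiveSpace 1 | CoordNeZero 0 q} :=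
      (hu.comp_continuousOn (continuousOn_affineCoordComplex_apply 0)).congr
        fun q hq => twoChartGlue_of_coordNeZero_zero hq
    exact hc.continuousAt ((isOpen_setOf_coordNeZero 0).mem_nhds h0)
  · have h1 := coordNeZero_one_of_not_coordNeZero_zero h0
    have hc : ContinuousOn (twoChartGlue u v) {q : ComplexProjectiveSpace 1 | CoordNeZero 1 q} :=
      (hv.comp_continuousOn (continuousOn_affineCoordComplex_apply 1)).congr
        fun q hq => twoChartGlue_of_coordNeZero_one huv hq
    exact hc.continuousAt ((isOpen_setOf_coordNeZero 1).mem_nhds h1)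

/-- **The two-chart sphere** `ℂP¹ → X` glued from compatible continuous charts `u, v`.
[folklore] -/
def twoChartSphere (u v : ℂ → X) (hu : Continuous u) (hv : Continuous v)
    (huv : ∀ z : ℂ, z ≠ 0 → v z = u z⁻¹) : C(ComplexProjectiveSpace 1, X) :=
  ⟨twoChartGlue u v, continuous_twoChartGlue hu hv huv⟩

/-- First compatibility, in the form used by `sphere_zeroSetIndex_factorsThroughHomology_of_isClosed`.
[folklore] -/
theorem twoChartSphere_apply_of_coordNeZero_zero {hu : Continuous u} {hv : Continuous v}
    {huv : ∀ z : ℂ, z ≠ 0 → v z = u z⁻¹} (q : ComplexProjectiveSpace 1) (h0 : CoordNeZero 0 q) :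
    twoChartSphere u v hu hv huv q = u (affineCoordComplex 0 q 0) :=
  twoChartGlue_of_coordNeZero_zero h0

/-- Second compatibility, in the form used by `sphere_zeroSetIndex_factorsThroughHomology_of_isClosed`.
[folklore] -/
theorem twoChartSphere_apply_of_coordNeZero_one {hu : Continuous u} {hv : Continuous v}
    {huv : ∀ z : ℂ, z ≠ 0 → v z = u z⁻¹} (q : ComplexProjectiveSpace 1) (h1 : CoordNeZero 1 q) :
    twoChartSphere u v hu hv huv q = v (affineCoordComplex 1 q 0) :=
  twoChartGlue_of_coordNeZero_one huv h1

/-- The image of the two-chart sphere is `range u ∪ range v`. [folklore] -/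
theorem range_twoChartSphere {hu : Continuous u} {hv : Continuous v}
    {huv : ∀ z : ℂ, z ≠ 0 → v z = u z⁻¹} :
    range (twoChartSphere u v hu hv huv) = range u ∪ range v := by
  apply Subset.antisymm
  · rintro x ⟨q, rfl⟩
    by_cases h0 : CoordNeZero 0 q
    · exact Or.inl ⟨_, (twoChartGlue_of_coordNeZero_zero h0).symm⟩
    · exact Or.inr ⟨_, (twoChartGlue_of_not_coordNeZero_zero h0).symm⟩
  · rintro x (⟨z, rfl⟩ | ⟨z, rfl⟩)
    · refine ⟨(affineChart 0).symm (realCoordinates 1 (fun _ : Fin 1 => z)), ?_⟩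
      show twoChartGlue u v _ = u z
      rw [twoChartGlue_of_coordNeZero_zero (coordNeZero_affineChart_symm 0 _),
        affineCoordComplex_affineChart_symm]
    · refine ⟨(affineChart 1).symm (realCoordinates 1 (fun _ : Fin 1 => z)), ?_⟩
      show twoChartGlue u v _ = v z
      rw [twoChartGlue_of_coordNeZero_one huv (coordNeZero_affineChart_symm 1 _),
        affineCoordComplex_affineChart_symm]

end Glue

/-! ### §2 `H₂(M; ℤ) = 0` for a homotopy 4-sphere -/

section Homology

/-- **`H₂(M; ℤ) = 0` when `M ≃ₕ S⁴`** (homotopy invariance and `H₂(S⁴; ℤ) = 0`).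
[cite: Hatcher2002, Cor. 2.11 and Cor. 2.14] -/
theorem isZero_singularHomology_two_of_homotopyEquiv_sphere_four (M : Type) [TopologicalSpace M]
    (e : ContinuousMap.HomotopyEquiv M (Metric.sphere (0 : EuclideanSpace ℝ (Fin 5)) 1)) :
    IsZero (singularHomology ℤ ℤ M (2 * 1)) :=
  (isZero_singularHomology_sphere_holds ℤ ℤ (n := 4) (k := 2 * 1) (by norm_num) (by norm_num)).of_iso
    (singularHomology.isoOfHomotopyEquiv ℤ ℤ e (2 * 1))

/-- **Every additive functional on `H₂(M; ℤ)` of a homotopy 4-sphere vanishes identically.**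
In the universality clause of the pencil statement this kills the homological intersection count
`c (F_*[ℂP¹])` of every capped member `F`. [cite: Wendl2018, Prop. 2.53 with Thm. 2.49] -/
theorem addMonoidHom_apply_eq_zero_of_homotopyEquiv (M : Type) [TopologicalSpace M]
    (hM : Nonempty (ContinuousMap.HomotopyEquiv M (Metric.sphere (0 : EuclideanSpace ℝ (Fin 5)) 1)))
    (c : singularHomology ℤ ℤ M (2 * 1) →+ ℤ) (x : singularHomology ℤ ℤ M (2 * 1)) : c x = 0 := by
  obtain ⟨e⟩ := hM
  have hZ := isZero_singularHomology_two_of_homotopyEquiv_sphere_four M e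
  have hx : x = 0 := (ModuleCat.isZero_iff_subsingleton.1 hZ).elim x 0
  rw [hx, map_zero]

end Homology

/-! ### §3 The capped member as a sphere in `M` -/

namespace IsPencilPlane

variable {M : Type*} [TopologicalSpace M] [T2Space M] [SecondCountableTopology M] [CompactSpace M]
  [ChartedSpace (EuclideanSpace ℝ (Fin 4)) M] [IsManifold (𝓡 4) ∞ M]
  {p : M} {J : ∀ x : punctured p, TangentSpace (𝓡 4) x →L[ℝ] TangentSpace (𝓡 4) x}
  {u : ℂ → punctured p} {b : ℂ} {ε : ℝ}

omit [SecondCountableTopology M] in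
/-- **The capped member** `û : ℂP¹ → M`: `u` on `ℂ = {v₀ ≠ 0}`, the cap chart `pencilCap p u`
(`η ↦ u (η⁻¹)`, `0 ↦ p`) on `{v₁ ≠ 0}`. [cite: Wendl2018, Prop. 2.53 (proof sketch, p. 65)] -/
def capSphere (h : IsPencilPlane J u b) (hε : 0 < ε)
    (hJstd : ∀ x : punctured p, InPuncturedChartBall p ε x →
      ∀ (v : TangentSpace (𝓡 4) x) (c : EuclideanSpace ℝ (Fin 4)),
        inner ℝ (fderiv ℝ inversion (extChartAt (𝓡 4) p x.1 - extChartAt (𝓡 4) p p)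
          (mfderiv (𝓡 4) 𝓘(ℝ, EuclideanSpace ℝ (Fin 4))
            (fun z : punctured p => extChartAt (𝓡 4) p z.1) x (J x v))) c
        = stdSymplecticForm (fderiv ℝ inversion (extChartAt (𝓡 4) p x.1 - extChartAt (𝓡 4) p p)
          (mfderiv (𝓡 4) 𝓘(ℝ, EuclideanSpace ℝ (Fin 4))
            (fun z : punctured p => extChartAt (𝓡 4) p z.1) x v)) c) :
    C(ComplexProjectiveSpace 1, M) :=
  twoChartSphere (fun ξ => (u ξ).1) (pencilCap p u)
    (continuous_subtype_val.comp h.continuous) (h.continuous_pencilCap hε hJstd)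
    fun _ hz => pencilCap_of_ne_zero hz

end IsPencilPlane

end Literature.Geometry.Symplectic
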